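import Summits.CriticalPhenomena.PercolationContinuityZ3.Theorems.PercNearOneGluingNoHeavyQuantTorqueRoutes
import Summits.CriticalPhenomena.PercolationContinuityZ3.Theorems.PercNearOneGluingNoHeavyQuantSymTriple
import HarnessLib

/-!
# QUANT lane R8, T-DEC: THE MINIMAL OPEN INSTANCE "THREE IDENTICAL 2-CHAINS" IS SDEC AT EVERY ADMISSIBLE FLOOR, FOR EVERY ROOT GATE —
# a LAYER-FREE torque-cost certificate with ONE route per positive low atom (arm-1 gen 54, architect)

builds on p205010 (kernel theorem, internal audit signed; external expert review pending)

Support file (`--supports stmt-CriticalPhenomena-4575`), QUANT lane seat prim-quant-arm-1 (gen 54, architect); memo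
`run/shared/lean/prim/quant/prim-quant-arm-1-g54/ARCH-G54.md`.  Theorems only, standard axioms, no sorries.  Consumes arm-1 g50's torque-cost
criterion through the fixed-route layer `…QuantTorqueRoutes` (this seat: `decAt_all_of_noPosLow/oneRoute/twoRoutes`, `freeRate_le_sixth`,
`route_cap6`, `route_cost6`) and the forest-law vocabulary `Sib`, `flaw`, `ftop`, `Sib.TreeOK` (`…QuantForestData`, `…QuantForestBridge`).

THE INSTANCE (README V393, lead g42; arm-1 g53 ARCH-G53 §2c/§2f: "THE minimal open instance"): three identical 2-chains under one gate,
`t = gate_q(δ₁ ∗ gate_p δ₁)` — root gate `q`, a relay, an inner gate `p`, a relay —, i.e. the forest law `(gate_q ρ_p)^{∗3}` on `{0..6}` with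
`ρ_p = {1: 1−p, 2: p}` and mean `3q(1+p)`.  Gen 53 proved it SDEC given the oracle at its true floor for `q ≤ 1/2` (`sdec_symTriple_trueFloor`,
any composite `t`) and showed that for `q > 1/2` NO common-target mixture of oracle laws exists at the true floor (pen no-go, memo ARCH-G53 §2c),
while exact per-layer flow LPs pass.  THIS FILE: for EVERY `0 < q < 1`, `0 < p < 1` and EVERY floor `0 < x` with `2x ≤ q(1+p)` (all
top-affordable floors — in particular every floor at which `t` is tree-OK, `x ≤ q·x₁ ≤ q(1+p)/2`): `SDEC x 6 ((gate_q ρ_p)^{∗3})` — NO oracle,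
NO restriction on `q`.

THE CERTIFICATE (layer-free, per outer gate `a`; `T = 3aq(1+p)` the gated mean, `y = a·x ≤ T/6` the gated floor).  The positive low atoms of
`gate_a(t∗t∗t)` are `l = 1` (iff `T > 2`) and `l = 2` (iff `T > 4`); ship each through ONE route at the layer-free rate `freeRate` and let the zero
atom ride the remaining torque (`decAt_all_of_torqueCost`):  `T ≤ 2`: nothing to ship;  `2 < T ≤ 3`: `1 → 3`;  `3 < T ≤ 4`: `1 → 4`;
`4 < T < 6`: `1 → 5` and `2 → 4`.  On every route used the gate `max(y, (T−2l)/(h−l))` is at most `T/6`, so the rate is at most `T/(6−T)` and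
the capacities reduce to FOUR polynomial inequalities — `T·(f₁+f₃) ≤ 6f₃` (`2 < T ≤ 3`), `T·(f₁+f₄) ≤ 6f₄` (`3 < T ≤ 4`), `T·(f₁+f₅) ≤ 6f₅` and
`T·(f₂+f₄) ≤ 6f₄` (`4 < T`), `f_h` the atoms of `t∗t∗t`, each `T ≤ 3q(1+p)` — proved below by explicit decompositions into nonnegative terms;
the torque cost of the one costly route is at most `μ₁·(T−1)` because `(h−T)·T ≤ (T−1)(6−T)`.  (Numerically the same four routes certify every
NON-identical triple of 2-chains at its true floor as well — 4 000/4 000 random instances, memo §2; only the identical case is typed here.)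

* `tc_rho_apply`, `gate_tc_apply`, `flaw_tc3_eq`, `flaw_tc3_one … flaw_tc3_five`: the atoms `f₁ = 3q(1−q)²(1−p)`, `f₂ = 3q(1−q)A`,
  `f₃ = q²(1−p)E`, `f₄ = 3q²pA`, `f₅ = 3q³p²(1−p)` (`A = (1−q)p + q(1−p)²`, `E = 6(1−q)p + q(1−p)²`).
* (route bookkeeping and the criterion with zero / one / two fixed routes: `…QuantTorqueRoutes`, this seat.)
* `tc_capB`, `tc_capC`, `tc_capD₁`, `tc_capD₂`: the four capacity inequalities.
* **`sdec_tc3`**: `0 < q < 1`, `0 < p < 1`, `0 < x`, `2x ≤ q(1+p)` ⟹ `SDEC x 6 (flaw [t,t,t])`;  `tc_treeOK` (the tree-OK floors are exactly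
  `x ≤ q·x₁`, `x₁ < p`);  **`sdec_symTriple_twoChain`**: `t.TreeOK x` ⟹ `SDEC x (ftop [t,t,t]) (flaw [t,t,t])`, no oracle, every `q`.

HONEST STATUS.  Closes the symmetric three-2-chains instance (all root gates, all admissible floors); non-identical triples, `SiblingStep`,
`GateStepN`, `LightResidDECOracle`, `FarTreeRow` remain OPEN; RATE class (log\*) / honest sentence of `run/shared/lean/prim/quant/README.md`
unchanged.  [this work].  Nothing here is cited as a published result.  The gluing rows served [cite: KozmaNitzan2024, Conjecture 3 (p. 15)];
product measure [cite: Grimmett1999, §1.3 p. 10].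
-/

noncomputable section

open scoped BigOperators

namespace Summit.CriticalPhenomena.PercolationContinuityZ3.Theorems
namespace Quant
namespace LawDec

open Finset

/-- the point mass `δ_K` -/
local notation3 "δ[" K "]" => (fun k : ℕ => if k = (K : ℕ) then (1 : ℝ) else 0)

/-- the 2-chain sub-forest law `ρ_p = δ₁ ∗ gate_p δ₁` (a root relay with one relay child behind the gate `p`) -/
local notation3 "ρ₂[" p "]" => lconv 1 1 (fun k : ℕ => if k = (1 : ℕ) then (1 : ℝ) else 0)
  (gate (fun k : ℕ => if k = (1 : ℕ) then (1 : ℝ) else 0) p)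

/-- the 2-chain sibling `t = gate_q(δ₁ ∗ gate_p δ₁)` with recorded sub-floor `x₁` and gate count `1` -/
local notation3 "TC[" q ", " p ", " x₁ "]" => (⟨q, x₁, 1, 2, ρ₂[p]⟩ : Sib)

/-- the symmetric triple of 2-chains -/
local notation3 "L₃[" q ", " p ", " x₁ "]" => ([TC[q, p, x₁], TC[q, p, x₁], TC[q, p, x₁]] : List Sib)

/-! ### The atoms of the law -/

/-- the 2-chain sub-forest law: `ρ_p = {1: 1−p, 2: p}`. [this work] -/
theorem tc_rho_apply (p : ℝ) (h : ℕ) :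
    (ρ₂[p]) h = (if h = 1 then 1 - p else 0) + (if h = 2 then p else 0) := by
  by_cases h0 : h = 0
  · subst h0; norm_num [lconv, Finset.sum_range_succ, gate_apply]
  by_cases h1 : h = 1
  · subst h1; norm_num [lconv, Finset.sum_range_succ, gate_apply]
  by_cases h2 : h = 2
  · subst h2; norm_num [lconv, Finset.sum_range_succ, gate_apply]
  rw [if_neg h1, if_neg h2, add_zero]
  exact lconv_eq_zero 1 1 _ _ h (by omega)

/-- the gated 2-chain: `gate_q ρ_p = {0: 1−q, 1: q(1−p), 2: qp}`. [this work] -/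
theorem gate_tc_apply (q p : ℝ) (h : ℕ) :
    gate (ρ₂[p]) q h = (if h = 0 then 1 - q else 0) + (if h = 1 then q * (1 - p) else 0) + (if h = 2 then q * p else 0) := by
  rw [gate_apply, tc_rho_apply]
  by_cases h0 : h = 0
  · subst h0; norm_num
  by_cases h1 : h = 1
  · subst h1; norm_num
  by_cases h2 : h = 2
  · subst h2; norm_num
  rw [if_neg h1, if_neg h2, if_neg h0, if_neg h0, if_neg h1, if_neg h2]; ring

/-- the forest law of three identical 2-chains as a nested convolution of the gated 2-chain. [this work] -/
theorem flaw_tc3_eq (q p x₁ : ℝ) :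
    flaw [TC[q, p, x₁], TC[q, p, x₁], TC[q, p, x₁]] = lconv 4 2 (lconv 2 2 (gate (ρ₂[p]) q) (gate (ρ₂[p]) q)) (gate (ρ₂[p]) q) := by
  have e1 : lconv 0 2 δ[0] (gate (ρ₂[p]) q) = gate (ρ₂[p]) q := by
    funext k
    refine lconv_delta_left 0 2 _ (fun i hi => ?_) k
    rw [gate_tc_apply, if_neg (by omega), if_neg (by omega), if_neg (by omega)]; ring
  show lconv (0 + 2 + 2) 2 (lconv (0 + 2) 2 (lconv 0 2 δ[0] (gate (ρ₂[p]) q)) (gate (ρ₂[p]) q)) (gate (ρ₂[p]) q) = _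
  rw [e1]

/-- `f₁ = 3q(1−q)²(1−p)`. [this work] -/
theorem flaw_tc3_one (q p x₁ : ℝ) :
    flaw [TC[q, p, x₁], TC[q, p, x₁], TC[q, p, x₁]] 1 = 3 * q * (1 - q) ^ 2 * (1 - p) := by
  rw [flaw_tc3_eq]; simp only [lconv, Finset.sum_range_succ, Finset.sum_range_zero, gate_tc_apply]; norm_num; ring

/-- `f₂ = 3q(1−q)·((1−q)p + q(1−p)²)`. [this work] -/
theorem flaw_tc3_two (q p x₁ : ℝ) :
    flaw [TC[q, p, x₁], TC[q, p, x₁], TC[q, p, x₁]] 2 = 3 * q * (1 - q) * ((1 - q) * p + q * (1 - p) ^ 2) := by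
  rw [flaw_tc3_eq]; simp only [lconv, Finset.sum_range_succ, Finset.sum_range_zero, gate_tc_apply]; norm_num; ring

/-- `f₃ = q²(1−p)·(6(1−q)p + q(1−p)²)`. [this work] -/
theorem flaw_tc3_three (q p x₁ : ℝ) :
    flaw [TC[q, p, x₁], TC[q, p, x₁], TC[q, p, x₁]] 3 = q ^ 2 * (1 - p) * (6 * (1 - q) * p + q * (1 - p) ^ 2) := by
  rw [flaw_tc3_eq]; simp only [lconv, Finset.sum_range_succ, Finset.sum_range_zero, gate_tc_apply]; norm_num; ring

/-- `f₄ = 3q²p·((1−q)p + q(1−p)²)`. [this work] -/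
theorem flaw_tc3_four (q p x₁ : ℝ) :
    flaw [TC[q, p, x₁], TC[q, p, x₁], TC[q, p, x₁]] 4 = 3 * q ^ 2 * p * ((1 - q) * p + q * (1 - p) ^ 2) := by
  rw [flaw_tc3_eq]; simp only [lconv, Finset.sum_range_succ, Finset.sum_range_zero, gate_tc_apply]; norm_num; ring

/-- `f₅ = 3q³p²(1−p)`. [this work] -/
theorem flaw_tc3_five (q p x₁ : ℝ) :
    flaw [TC[q, p, x₁], TC[q, p, x₁], TC[q, p, x₁]] 5 = 3 * q ^ 3 * p ^ 2 * (1 - p) := by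
  rw [flaw_tc3_eq]; simp only [lconv, Finset.sum_range_succ, Finset.sum_range_zero, gate_tc_apply]; norm_num; ring

/-! ### The four capacity inequalities -/

/-- **regime `2 < T ≤ 3`, route `1 → 3`**: `2 ≤ T ≤ 3q(1+p)` ⟹ `T·(f₁ + f₃) ≤ 6·f₃`.  Certificate: `6f₃ − T(f₁+f₃) = q(1−p)·[(3s − T)(3Q² + qE) + 3N]`,
`s = q(1+p)`, `Q = 1−q`, `E = 6Qp + q(1−p)²`, `N = (2−s)qE − 3sQ² ≥ 0` for `3s ≥ 2` (two explicit decompositions, `p ≤ 1/3` / `p ≥ 1/3`). [this work] -/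
theorem tc_capB (q p T : ℝ) (hq0 : 0 ≤ q) (hq1 : q ≤ 1) (hp0 : 0 ≤ p) (hp1 : p ≤ 1) (hT2 : 2 ≤ T) (hTs : T ≤ 3 * q * (1 + p)) :
    T * (3 * q * (1 - q) ^ 2 * (1 - p) + q ^ 2 * (1 - p) * (6 * (1 - q) * p + q * (1 - p) ^ 2))
      ≤ 6 * (q ^ 2 * (1 - p) * (6 * (1 - q) * p + q * (1 - p) ^ 2)) := by
  have hQ : 0 ≤ 1 - q := by linarith
  have hP : 0 ≤ 1 - p := by linarith
  have hh : 0 ≤ 3 * (q * (1 + p)) - 2 := by linarith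
  have h3 : 0 ≤ 3 * (q * (1 + p)) - T := by linarith
  -- N ≥ 0
  have hN : 0 ≤ (2 - q * (1 + p)) * q * (6 * (1 - q) * p + q * (1 - p) ^ 2) - 3 * (q * (1 + p)) * (1 - q) ^ 2 := by
    rcases le_total p (1 / 3) with hp3 | hp3
    · have h13 : 0 ≤ 1 - 3 * p := by linarith
      have key : (2 - q * (1 + p)) * q * (6 * (1 - q) * p + q * (1 - p) ^ 2) - 3 * (q * (1 + p)) * (1 - q) ^ 2
          = q * (1 - q) * (1 - 3 * p) * (3 * (q * (1 + p)) - 2)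
            + q * (1 - q) * (2 / 3 * (3 * (q * (1 + p)) - 2) + 1 / 3 + 3 * p * (1 - q) + 5 * q * p ^ 2)
            + q ^ 3 * (1 - p) ^ 3 := by ring
      rw [key]
      have t1 : 0 ≤ q * (1 - q) * (1 - 3 * p) * (3 * (q * (1 + p)) - 2) :=
        mul_nonneg (mul_nonneg (mul_nonneg hq0 hQ) h13) hh
      have t2 : 0 ≤ q * (1 - q) * (2 / 3 * (3 * (q * (1 + p)) - 2) + 1 / 3 + 3 * p * (1 - q) + 5 * q * p ^ 2) :=
        mul_nonneg (mul_nonneg hq0 hQ) (by positivity)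
      have t3 : 0 ≤ q ^ 3 * (1 - p) ^ 3 := by positivity
      linarith
    · have h31 : 0 ≤ 3 * p - 1 := by linarith
      have key : (2 - q * (1 + p)) * q * (6 * (1 - q) * p + q * (1 - p) ^ 2) - 3 * (q * (1 + p)) * (1 - q) ^ 2
          = 3 * q * (1 - q) ^ 2 * (3 * p - 1) + 2 * q ^ 2 * (1 - q) * (1 - p) ^ 2 + 6 * q ^ 2 * (1 - q) * (1 - p) * p
            + q ^ 3 * (1 - p) ^ 3 := by ring
      rw [key]
      have t1 : 0 ≤ 3 * q * (1 - q) ^ 2 * (3 * p - 1) := by positivity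
      have t2 : 0 ≤ 2 * q ^ 2 * (1 - q) * (1 - p) ^ 2 := by positivity
      have t3 : 0 ≤ 6 * q ^ 2 * (1 - q) * (1 - p) * p := by positivity
      have t4 : 0 ≤ q ^ 3 * (1 - p) ^ 3 := by positivity
      linarith
  have key : 6 * (q ^ 2 * (1 - p) * (6 * (1 - q) * p + q * (1 - p) ^ 2))
      - T * (3 * q * (1 - q) ^ 2 * (1 - p) + q ^ 2 * (1 - p) * (6 * (1 - q) * p + q * (1 - p) ^ 2))
      = q * (1 - p) * ((3 * (q * (1 + p)) - T) * (3 * (1 - q) ^ 2 + q * (6 * (1 - q) * p + q * (1 - p) ^ 2))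
        + 3 * ((2 - q * (1 + p)) * q * (6 * (1 - q) * p + q * (1 - p) ^ 2) - 3 * (q * (1 + p)) * (1 - q) ^ 2)) := by ring
  have hB : 0 ≤ 3 * (1 - q) ^ 2 + q * (6 * (1 - q) * p + q * (1 - p) ^ 2) := by positivity
  have : 0 ≤ q * (1 - p) * ((3 * (q * (1 + p)) - T) * (3 * (1 - q) ^ 2 + q * (6 * (1 - q) * p + q * (1 - p) ^ 2))
        + 3 * ((2 - q * (1 + p)) * q * (6 * (1 - q) * p + q * (1 - p) ^ 2) - 3 * (q * (1 + p)) * (1 - q) ^ 2)) :=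
    mul_nonneg (mul_nonneg hq0 hP) (add_nonneg (mul_nonneg h3 hB) (by linarith))
  linarith

/-- `qpA − 2Q²(1−p) ≥ 0` for `q(1+p) ≥ 1` (`A = Qp + q(1−p)²`): `= 2Q(1−p)(s−1) + qp·[q(1−p)² − Q(2−3p)]`, the bracket being
`q(1−2p)² + (s−1)(2−3p)` for `p ≤ 2/3` and a sum of two nonnegative terms for `p ≥ 2/3`. [this work] -/
theorem tc_qpA_sub (q p : ℝ) (hq0 : 0 ≤ q) (hq1 : q ≤ 1) (hp0 : 0 ≤ p) (hp1 : p ≤ 1) (hs : 1 ≤ q * (1 + p)) :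
    0 ≤ q * p * ((1 - q) * p + q * (1 - p) ^ 2) - 2 * (1 - q) ^ 2 * (1 - p) := by
  have hQ : 0 ≤ 1 - q := by linarith
  have hP : 0 ≤ 1 - p := by linarith
  have hs1 : 0 ≤ q * (1 + p) - 1 := by linarith
  have hbr : 0 ≤ q * (1 - p) ^ 2 - (1 - q) * (2 - 3 * p) := by
    rcases le_total p (2 / 3) with hp3 | hp3
    · have key : q * (1 - p) ^ 2 - (1 - q) * (2 - 3 * p) = q * (1 - 2 * p) ^ 2 + (q * (1 + p) - 1) * (2 - 3 * p) := by ring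
      rw [key]
      have : 0 ≤ (q * (1 + p) - 1) * (2 - 3 * p) := mul_nonneg hs1 (by linarith)
      positivity
    · have : 0 ≤ (1 - q) * (3 * p - 2) := mul_nonneg hQ (by linarith)
      nlinarith [mul_nonneg hq0 (sq_nonneg (1 - p))]
  have key : q * p * ((1 - q) * p + q * (1 - p) ^ 2) - 2 * (1 - q) ^ 2 * (1 - p)
      = 2 * (1 - q) * (1 - p) * (q * (1 + p) - 1) + q * p * (q * (1 - p) ^ 2 - (1 - q) * (2 - 3 * p)) := by ring
  rw [key]
  have t1 : 0 ≤ 2 * (1 - q) * (1 - p) * (q * (1 + p) - 1) := by positivity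
  have t2 : 0 ≤ q * p * (q * (1 - p) ^ 2 - (1 - q) * (2 - 3 * p)) := mul_nonneg (mul_nonneg hq0 hp0) hbr
  linarith

/-- **regime `3 < T ≤ 4`, route `1 → 4`**: `3 ≤ T ≤ 4`, `T ≤ 3q(1+p)` ⟹ `T·(f₁ + f₄) ≤ 6·f₄`.  Certificate:
`6f₄ − T(f₁+f₄) = 3q·[(4−T)(Q²(1−p) + qpA) + 2(qpA − 2Q²(1−p))]`. [this work] -/
theorem tc_capC (q p T : ℝ) (hq0 : 0 ≤ q) (hq1 : q ≤ 1) (hp0 : 0 ≤ p) (hp1 : p ≤ 1) (hT3 : 3 ≤ T) (hT4 : T ≤ 4)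
    (hTs : T ≤ 3 * q * (1 + p)) :
    T * (3 * q * (1 - q) ^ 2 * (1 - p) + 3 * q ^ 2 * p * ((1 - q) * p + q * (1 - p) ^ 2))
      ≤ 6 * (3 * q ^ 2 * p * ((1 - q) * p + q * (1 - p) ^ 2)) := by
  have hsub := tc_qpA_sub q p hq0 hq1 hp0 hp1 (by linarith)
  have key : 6 * (3 * q ^ 2 * p * ((1 - q) * p + q * (1 - p) ^ 2))
      - T * (3 * q * (1 - q) ^ 2 * (1 - p) + 3 * q ^ 2 * p * ((1 - q) * p + q * (1 - p) ^ 2))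
      = 3 * q * ((4 - T) * ((1 - q) ^ 2 * (1 - p) + q * p * ((1 - q) * p + q * (1 - p) ^ 2))
        + 2 * (q * p * ((1 - q) * p + q * (1 - p) ^ 2) - 2 * (1 - q) ^ 2 * (1 - p))) := by ring
  have hQ : 0 ≤ 1 - q := by linarith
  have hP : 0 ≤ 1 - p := by linarith
  have hB : 0 ≤ (1 - q) ^ 2 * (1 - p) + q * p * ((1 - q) * p + q * (1 - p) ^ 2) := by positivity
  have : 0 ≤ 3 * q * ((4 - T) * ((1 - q) ^ 2 * (1 - p) + q * p * ((1 - q) * p + q * (1 - p) ^ 2))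
        + 2 * (q * p * ((1 - q) * p + q * (1 - p) ^ 2) - 2 * (1 - q) ^ 2 * (1 - p))) :=
    mul_nonneg (by positivity) (add_nonneg (mul_nonneg (by linarith) hB) (by linarith))
  linarith

/-- **regime `4 < T < 6`, route `1 → 5`**: `4 ≤ T ≤ 3q(1+p)` ⟹ `T·(f₁ + f₅) ≤ 6·f₅`.  Certificate:
`6f₅ − T(f₁+f₅) = 3q(1−p)·[(3s−T)(Q² + q²p²) + 3(s−1)(Q·q(1−p) + q(1−p)(s−1) + Q·s)]`. [this work] -/
theorem tc_capD₁ (q p T : ℝ) (hq0 : 0 ≤ q) (hq1 : q ≤ 1) (hp0 : 0 ≤ p) (hp1 : p ≤ 1) (hT4 : 4 ≤ T) (hTs : T ≤ 3 * q * (1 + p)) :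
    T * (3 * q * (1 - q) ^ 2 * (1 - p) + 3 * q ^ 3 * p ^ 2 * (1 - p)) ≤ 6 * (3 * q ^ 3 * p ^ 2 * (1 - p)) := by
  have hQ : 0 ≤ 1 - q := by linarith
  have hP : 0 ≤ 1 - p := by linarith
  have hs1 : 0 ≤ q * (1 + p) - 1 := by linarith
  have h3 : 0 ≤ 3 * (q * (1 + p)) - T := by linarith
  have key : 6 * (3 * q ^ 3 * p ^ 2 * (1 - p)) - T * (3 * q * (1 - q) ^ 2 * (1 - p) + 3 * q ^ 3 * p ^ 2 * (1 - p))
      = 3 * q * (1 - p) * ((3 * (q * (1 + p)) - T) * ((1 - q) ^ 2 + q ^ 2 * p ^ 2)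
        + 3 * (q * (1 + p) - 1) * ((1 - q) * (q * (1 - p)) + q * (1 - p) * (q * (1 + p) - 1) + (1 - q) * (q * (1 + p)))) := by
    ring
  have : 0 ≤ 3 * q * (1 - p) * ((3 * (q * (1 + p)) - T) * ((1 - q) ^ 2 + q ^ 2 * p ^ 2)
        + 3 * (q * (1 + p) - 1) * ((1 - q) * (q * (1 - p)) + q * (1 - p) * (q * (1 + p) - 1) + (1 - q) * (q * (1 + p)))) := by
    positivity
  linarith

/-- **regime `4 < T < 6`, route `2 → 4`**: `4 ≤ T ≤ 3q(1+p)` ⟹ `T·(f₂ + f₄) ≤ 6·f₄`.  Certificate: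
`6f₄ − T(f₂+f₄) = 3qA·[(3s−T)(Q + qp) + 3q(1−p)(s−1)]`. [this work] -/
theorem tc_capD₂ (q p T : ℝ) (hq0 : 0 ≤ q) (hq1 : q ≤ 1) (hp0 : 0 ≤ p) (hp1 : p ≤ 1) (hT4 : 4 ≤ T) (hTs : T ≤ 3 * q * (1 + p)) :
    T * (3 * q * (1 - q) * ((1 - q) * p + q * (1 - p) ^ 2) + 3 * q ^ 2 * p * ((1 - q) * p + q * (1 - p) ^ 2))
      ≤ 6 * (3 * q ^ 2 * p * ((1 - q) * p + q * (1 - p) ^ 2)) := by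
  have hQ : 0 ≤ 1 - q := by linarith
  have hP : 0 ≤ 1 - p := by linarith
  have hs1 : 0 ≤ q * (1 + p) - 1 := by linarith
  have h3 : 0 ≤ 3 * (q * (1 + p)) - T := by linarith
  have key : 6 * (3 * q ^ 2 * p * ((1 - q) * p + q * (1 - p) ^ 2))
      - T * (3 * q * (1 - q) * ((1 - q) * p + q * (1 - p) ^ 2) + 3 * q ^ 2 * p * ((1 - q) * p + q * (1 - p) ^ 2))
      = 3 * q * ((1 - q) * p + q * (1 - p) ^ 2) * ((3 * (q * (1 + p)) - T) * ((1 - q) + q * p)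
        + 3 * q * (1 - p) * (q * (1 + p) - 1)) := by ring
  have : 0 ≤ 3 * q * ((1 - q) * p + q * (1 - p) ^ 2) * ((3 * (q * (1 + p)) - T) * ((1 - q) + q * p)
        + 3 * q * (1 - p) * (q * (1 + p) - 1)) := by positivity
  linarith

/-! ### Assembly -/

/-- **THREE IDENTICAL 2-CHAINS ARE SDEC AT EVERY TOP-AFFORDABLE FLOOR, FOR EVERY ROOT GATE.**  `0 < q < 1`, `0 < p < 1`, `0 < x`, `2x ≤ q(1+p)`
⟹ `SDEC x 6 (flaw [t,t,t])`, `t = gate_q(δ₁ ∗ gate_p δ₁)` (any recorded sub-floor `x₁`).  No oracle. [this work] -/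
theorem sdec_tc3 {q p x : ℝ} (hq0 : 0 < q) (hq1 : q < 1) (hp0 : 0 < p) (hp1 : p < 1) (hx0 : 0 < x)
    (hx : 2 * x ≤ q * (1 + p)) (x₁ : ℝ) :
    SDEC x 6 (flaw L₃[q, p, x₁]) := by
  intro a ha0 ha1 j hj
  -- scalars (small context for `nlinarith`)
  obtain ⟨T, hTdef⟩ : ∃ T : ℝ, T = 3 * a * q * (1 + p) := ⟨_, rfl⟩
  have hQ : 0 ≤ 1 - q := by linarith
  have hP : 0 ≤ 1 - p := by linarith
  have hqp : q * (1 + p) < 2 := by nlinarith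
  have hTs : T ≤ 3 * q * (1 + p) := by rw [hTdef]; nlinarith [mul_pos hq0 (by linarith : (0 : ℝ) < 1 + p)]
  have hyT : 6 * (a * x) ≤ T := by rw [hTdef]; nlinarith [mul_le_mul_of_nonneg_left hx ha0.le]
  have hT6 : T < 6 := by linarith
  have hT0 : 0 < T := by rw [hTdef]; positivity
  have hy0 : 0 < a * x := mul_pos ha0 hx0
  have hy1 : a * x < 1 := by linarith
  have hta : a * x * ((6 : ℕ) : ℝ) ≤ T := by push_cast; linarith
  -- law facts
  have ρ0 : ∀ h, 0 ≤ (ρ₂[p]) h := by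
    intro h; rw [tc_rho_apply]; split_ifs <;> linarith
  have ρM : ∀ h, 2 < h → (ρ₂[p]) h = 0 := by
    intro h hh; rw [tc_rho_apply, if_neg (by omega), if_neg (by omega)]; ring
  have ρ1 : ∑ h ∈ Finset.range (2 + 1), (ρ₂[p]) h = 1 := by
    simp [Finset.sum_range_succ, tc_rho_apply]
  have hOK : ∀ s ∈ L₃[q, p, x₁], s.LawOK := by
    intro s hs
    simp only [List.mem_cons, List.mem_nil_iff, or_false, or_self] at hs
    subst hs
    exact ⟨hq0, hq1, ρ0, ρM, ρ1⟩
  obtain ⟨f0, fM, f1, fmn⟩ := flaw_facts L₃[q, p, x₁] hOK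
  have htop : ftop L₃[q, p, x₁] = 6 := by rw [ftop_three]; rfl
  have hmeanρ : Sib.mean TC[q, p, x₁] = 1 + p := by
    simp [Sib.mean, Finset.sum_range_succ, tc_rho_apply]; ring
  have hfmean : fmean L₃[q, p, x₁] = 3 * q * (1 + p) := by
    simp only [fmean, hmeanρ]; ring
  rw [htop] at fM f1 fmn
  rw [hfmean] at fmn
  obtain ⟨g0, gM, g1⟩ := gate_laws 6 (flaw L₃[q, p, x₁]) a ha0.le ha1 f0 fM f1
  have gmn : ∑ h ∈ Finset.range (6 + 1), (h : ℝ) * gate (flaw L₃[q, p, x₁]) a h = T := by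
    rw [sum_mul_gate, fmn, hTdef]; ring
  -- the atoms of the gated law
  have μ1 : gate (flaw L₃[q, p, x₁]) a 1 = a * (3 * q * (1 - q) ^ 2 * (1 - p)) := by
    rw [gate_apply, flaw_tc3_one]; simp
  have μ2 : gate (flaw L₃[q, p, x₁]) a 2 = a * (3 * q * (1 - q) * ((1 - q) * p + q * (1 - p) ^ 2)) := by
    rw [gate_apply, flaw_tc3_two]; simp
  have μ3 : gate (flaw L₃[q, p, x₁]) a 3 = a * (q ^ 2 * (1 - p) * (6 * (1 - q) * p + q * (1 - p) ^ 2)) := by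
    rw [gate_apply, flaw_tc3_three]; simp
  have μ4 : gate (flaw L₃[q, p, x₁]) a 4 = a * (3 * q ^ 2 * p * ((1 - q) * p + q * (1 - p) ^ 2)) := by
    rw [gate_apply, flaw_tc3_four]; simp
  have μ5 : gate (flaw L₃[q, p, x₁]) a 5 = a * (3 * q ^ 3 * p ^ 2 * (1 - p)) := by
    rw [gate_apply, flaw_tc3_five]; simp
  -- regimes
  rcases le_or_gt T 2 with hT2 | hT2
  · exact decAt_all_of_noPosLow (a * x) 6 _ T hy0 hy1 g0 gM g1 gmn hT0 hT2 hta j hj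
  rcases le_or_gt T 3 with hT3 | hT3
  · -- route 1 → 3
    have hκ : freeRate (a * x) T 1 3 ≤ T / (6 - T) :=
      freeRate_le_sixth (a * x) T 1 3 hyT (by push_cast; linarith) hT6
    refine decAt_all_of_oneRoute (a * x) 6 3 _ T hy0 hy1 g0 gM g1 gmn hT2 (by linarith) hta (by norm_num) (by norm_num)
      (by push_cast; linarith) ?_ ?_ j hj
    · rw [μ1, μ3]
      exact route_cap6 _ T _ _ hκ hT6 (by positivity)
        (scale_cap6 a T _ _ ha0.le (tc_capB q p T hq0.le hq1.le hp0.le hp1.le hT2.le hTs))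
    · intro hT3'
      rw [μ1]
      exact route_cost6 _ T 3 _ hκ hT6 (by positivity) hT3'.le (route_cost_ineq T 3 (by linarith))
  rcases le_or_gt T 4 with hT4 | hT4
  · -- route 1 → 4
    have hκ : freeRate (a * x) T 1 4 ≤ T / (6 - T) :=
      freeRate_le_sixth (a * x) T 1 4 hyT (by push_cast; linarith) hT6
    refine decAt_all_of_oneRoute (a * x) 6 4 _ T hy0 hy1 g0 gM g1 gmn hT2 hT4 hta (by norm_num) (by norm_num)
      (by push_cast; linarith) ?_ ?_ j hj
    · rw [μ1, μ4]
      exact route_cap6 _ T _ _ hκ hT6 (by positivity)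
        (scale_cap6 a T _ _ ha0.le (tc_capC q p T hq0.le hq1.le hp0.le hp1.le hT3.le hT4 hTs))
    · intro hT4'
      rw [μ1]
      exact route_cost6 _ T 4 _ hκ hT6 (by positivity) hT4'.le (route_cost_ineq T 4 (by linarith))
  · -- routes 1 → 5 and 2 → 4
    have hκ₁ : freeRate (a * x) T 1 5 ≤ T / (6 - T) :=
      freeRate_le_sixth (a * x) T 1 5 hyT (by push_cast; linarith) hT6
    have hκ₂ : freeRate (a * x) T 2 4 ≤ T / (6 - T) :=
      freeRate_le_sixth (a * x) T 2 4 hyT (by push_cast; linarith) hT6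
    refine decAt_all_of_twoRoutes (a * x) 6 5 4 _ T hy0 hy1 g0 gM g1 gmn hT4 hT6.le hta (by norm_num) (by norm_num)
      (by push_cast; linarith) (by norm_num) (by norm_num) (by push_cast; linarith) (by push_cast; linarith) (by norm_num)
      ?_ ?_ ?_ j hj
    · rw [μ1, μ5]
      exact route_cap6 _ T _ _ hκ₁ hT6 (by positivity)
        (scale_cap6 a T _ _ ha0.le (tc_capD₁ q p T hq0.le hq1.le hp0.le hp1.le hT4.le hTs))
    · rw [μ2, μ4]
      exact route_cap6 _ T _ _ hκ₂ hT6 (by positivity)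
        (scale_cap6 a T _ _ ha0.le (tc_capD₂ q p T hq0.le hq1.le hp0.le hp1.le hT4.le hTs))
    · intro hT5'
      rw [μ1]
      exact route_cost6 _ T 5 _ hκ₁ hT6 (by positivity) hT5'.le (route_cost_ineq T 5 (by linarith))

/-- **the tree-OK floors of the 2-chain sibling**: `0 < q < 1`, `0 < p < 1`, `0 < x₁ < p`, `0 < x ≤ q·x₁` ⟹ `t.TreeOK x` (so the true floor
of `[t,t,t]` is `q·p⁻`, inside the range `2x ≤ q(1+p)` of `sdec_tc3`). [this work] -/
theorem tc_treeOK {q p x₁ x : ℝ} (hq0 : 0 < q) (hq1 : q < 1) (hp0 : 0 < p) (hp1 : p < 1) (hx₁0 : 0 < x₁) (hx₁p : x₁ < p)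
    (hx : x ≤ q * x₁) : Sib.TreeOK x TC[q, p, x₁] := by
  have hx₁1 : x₁ < 1 := lt_trans hx₁p hp1
  have hr : TreeBuiltN x₁ 0 1 (fun k : ℕ => if k = (1 : ℕ) then (1 : ℝ) else 0) := TreeBuiltN.relay x₁ hx₁0 hx₁1
  have hr' : TreeBuiltN (x₁ / p) 0 1 (fun k : ℕ => if k = (1 : ℕ) then (1 : ℝ) else 0) :=
    TreeBuiltN.relay (x₁ / p) (div_pos hx₁0 hp0) (by rw [div_lt_one hp0]; exact hx₁p)
  have hg : TreeBuiltN (p * (x₁ / p)) (0 + 1) 1 (gate (fun k : ℕ => if k = (1 : ℕ) then (1 : ℝ) else 0) p) :=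
    TreeBuiltN.gate p hp0 hp1 hr'
  have e : p * (x₁ / p) = x₁ := by field_simp
  rw [e] at hg
  unfold Sib.TreeOK
  refine ⟨hq0, hq1, hx, ?_, fun K hK => ?_⟩
  · show TreeBuiltN x₁ 1 2 (ρ₂[p])
    exact TreeBuiltN.conv hr hg
  have h1 : (ρ₂[p]) 1 = (if (1 : ℕ) = K then (1 : ℝ) else 0) := congrFun hK 1
  have h2 : (ρ₂[p]) 2 = (if (2 : ℕ) = K then (1 : ℝ) else 0) := congrFun hK 2
  rw [tc_rho_apply] at h1 h2
  norm_num at h1 h2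
  by_cases hK1 : (1 : ℕ) = K
  · rw [if_pos hK1] at h1
    rw [if_neg (by omega)] at h2
    linarith
  · rw [if_neg hK1] at h1
    linarith

/-- **THE SYMMETRIC TRIPLE OF 2-CHAINS IS SDEC AT ITS TRUE FLOOR FOR EVERY ROOT GATE — NO ORACLE.**  For a floor `0 < x`, `0 < p < 1` and the
2-chain sibling `t = gate_q(δ₁ ∗ gate_p δ₁)` tree-OK at `x` (any admissible sub-floor `x₁`): `SDEC x (ftop [t,t,t]) (flaw [t,t,t])`.  With
`sdec_symTriple_trueFloor` (gen 53: `q ≤ 1/2`, any composite `t`, given the oracle) this settles README V393's minimal open instance in its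
symmetric form for every `q`; the certificate is the layer-free torque transport of this file, not a mixture of oracle laws (none exists at the
true floor for `q > 1/2`, memo ARCH-G53 §2c). [this work] -/
theorem sdec_symTriple_twoChain {q p x₁ x : ℝ} (hx0 : 0 < x) (hp0 : 0 < p) (hp1 : p < 1) (ht : Sib.TreeOK x TC[q, p, x₁]) :
    SDEC x (ftop L₃[q, p, x₁]) (flaw L₃[q, p, x₁]) := by
  obtain ⟨hq0, hq1, hxq, hT, _⟩ := ht
  obtain ⟨_, _, _, _, _, hta⟩ := hT.lawFacts
  have hmean : ∑ k ∈ Finset.range (2 + 1), (k : ℝ) * (ρ₂[p]) k = 1 + p := by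
    simp [Finset.sum_range_succ, tc_rho_apply]; ring
  have hta' : x₁ * 2 ≤ 1 + p := by
    change x₁ * ((2 : ℕ) : ℝ) ≤ ∑ k ∈ Finset.range (2 + 1), (k : ℝ) * (ρ₂[p]) k at hta
    rw [hmean] at hta
    exact_mod_cast hta
  rw [ftop_three]
  exact sdec_tc3 hq0 hq1 hp0 hp1 hx0 (by nlinarith) x₁

end LawDec
end Quant
end Summit.CriticalPhenomena.PercolationContinuityZ3.Theorems
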